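import Summits.CriticalPhenomena.PercolationContinuityZ3.Theorems.PercNearOneGluingNoHeavyLowerTailNineTypeKernelsAll
import Summits.CriticalPhenomena.PercolationContinuityZ3.Theorems.PercNearOneGluingNoHeavyLowerTailQ44bTwoLinkNegCorrelation
import Summits.CriticalPhenomena.PercolationContinuityZ3.Theorems.PercNearOneGluingNoHeavyLowerTailSwitchRelaxQ44bPack23Measure
import Mathlib.Tactic.Linarith
import HarnessLib

/-!
# `Q44b-top` for every finite weighted graph: the eight join-top bad types of `Q44b` pack into the single top cell

Support file for crux `stmt-CriticalPhenomena-4575` (`NoHeavyLowerTail`), seat `prim-l12-p1` gen 11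
(`--supports stmt-CriticalPhenomena-4575`).  Theorems only: no definitions, no named facts, no sorries, no `native_decide`.

Bond percolation `μ = prodBernoulli w` with arbitrary edge weights on `Fin n`, four vertices `a b c y`; `cell w a b c y i`
(`…FourPointAtoms`) is the probability that the open clusters induce the `i`-th partition of `{a,b,c,y}` in the `pat4` order
`a|b|c|y, a|b|cy, a|by|c, a|bc|y, ay|b|c, ac|b|y, ab|c|y, a|bcy, ay|bc, ac|by, acy|b, ab|cy, aby|c, abc|y, abcy`.

THE ROW.  `Q44b-top` is the law shadow of the fibre conjecture (P1) of gen 7 (memo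
`run/shared/lean/prim/prim-l12/FROM-prim-l12-p1-g7-REIMER-CERTIFICATES.md` §4): the eight bad types of the nine-type kernel of `Q44b`
other than type 5 (`(ab|c|y, a|b|cy)`) have join `abcy`, and they pack into the top cell ALONE:

  `P(abcy)·P(a|b|c|y) ≥ [P(ab|cy) + P(ab|c|y)]·[P(ac|by) + P(ay|bc)] + P(ab|c|y)·[P(acy|b) + P(a|bcy)] + P(a|bcy)·[P(ac|b|y) + P(ay|b|c)]`.

It was certified by SAT on `B_4, B_5` (fibre form), census-clean on 2.03·10⁹ exact multi-scale instances (ttrl3 `QTOP-MULTISCALE.md`,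
sha256 76af6d52…), and partially proved by three-copy switching certificates (`SwitchRelax.Q44bTop346789.quad_nonneg`: types 3,4,6,7,8,9;
`…Top6789`).  PROOF FOR ALL `n` (this file, two lines): `Q44b` itself is now a theorem for every finite weighted graph
(prim-bnk-1 gen 19, `Q44b.row_nonneg_all` / `TwoCopyMono.q44b_pack_nine`, the nine-type count), and the difference
`Q44b − Q44b-top = P(ab|cy)·P(a|b|c|y) − P(ab|c|y)·P(a|b|cy)` is `≤ 0` by van den Berg–Häggström–Kahn two-set conditional negative
correlation (`Q44bExchange.twoLink_cells`, gen 7).  Hence `Q44b-top = Q44b − (that difference) ≥ 0`.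

Main results: `twoLink_cell` (the BHK row in `FourPointAtoms` cells), `q44bTop_cells` (the displayed inequality in cells),
`q44bTop_le` (the same with the products written out as in the table row).
-/

namespace Summit.CriticalPhenomena.PercolationContinuityZ3.Theorems

namespace Q44bTop

open FourPointAtoms

variable {n : ℕ} (w : Sym2 (Fin n) → unitInterval) (a b c y : Fin n)

/-- **BHK two-link negative correlation in cells**: `P(ab|cy)·P(a|b|c|y) ≤ P(ab|c|y)·P(a|b|cy)`, i.e.
`cell 11 · cell 0 ≤ cell 6 · cell 1` (from `Q44bExchange.twoLink_cells` and the six-event dictionary of `SwitchRelax.Q44bPack23`).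
[cite: VandenbergHaggstromKahn2005, Thm. 1.4 (p. 7) — corollary] -/
theorem twoLink_cell : cell w a b c y 11 * cell w a b c y 0 ≤ cell w a b c y 6 * cell w a b c y 1 := by
  have h := Q44bExchange.twoLink_cells w a b c y
  rw [SwitchRelax.Q44bPack23.rE1, SwitchRelax.Q44bPack23.rE8, SwitchRelax.Q44bPack23.rE2,
    SwitchRelax.Q44bPack23.rE7] at h
  exact h

/-- **`Q44b-top` on every finite weighted graph (cells).**  The eight join-top bad types of `Q44b` pack into the top cell:
`cell 11·(cell 9 + cell 8) + cell 6·(cell 9 + cell 8 + cell 10 + cell 7) + cell 7·(cell 5 + cell 4) ≤ cell 14 · cell 0`, i.e.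
`[P(ab|cy)+P(ab|c|y)]·[P(ac|by)+P(ay|bc)] + P(ab|c|y)·[P(acy|b)+P(a|bcy)] + P(a|bcy)·[P(ac|b|y)+P(ay|b|c)] ≤ P(abcy)·P(a|b|c|y)`.
Proof: `q44b_pack_nine` (all nine types ≤ `[P(ab|cy)+P(abcy)]·P(∅)`) plus `twoLink_cell` (`P(ab|cy)P(∅) ≤` the type-5 product). [this work] -/
theorem q44bTop_cells :
    cell w a b c y 11 * (cell w a b c y 9 + cell w a b c y 8) +
        cell w a b c y 6 * (cell w a b c y 9 + cell w a b c y 8 + cell w a b c y 10 + cell w a b c y 7) +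
        cell w a b c y 7 * (cell w a b c y 5 + cell w a b c y 4) ≤
      cell w a b c y 14 * cell w a b c y 0 := by
  have h9 := TwoCopyMono.q44b_pack_nine w a b c y
  have h2 := twoLink_cell w a b c y
  nlinarith [h9, h2]

/-- **`Q44b-top`, table form**: `P(abcy)·P(a|b|c|y) ≥ [P(ab|cy)+P(ab|c|y)]·[P(ac|by)+P(ay|bc)] + P(ab|c|y)·[P(acy|b)+P(a|bcy)]
+ P(a|bcy)·[P(ac|b|y)+P(ay|b|c)]` for every finite weighted graph and all marked vertices — the law shadow of the fibre conjecture (P1)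
(prim-l12-p1 gen 7) is a theorem for every `n`. [this work] -/
theorem q44bTop_le :
    (cell w a b c y 11 + cell w a b c y 6) * (cell w a b c y 9 + cell w a b c y 8) +
        cell w a b c y 6 * (cell w a b c y 10 + cell w a b c y 7) +
        cell w a b c y 7 * (cell w a b c y 5 + cell w a b c y 4) ≤
      cell w a b c y 14 * cell w a b c y 0 := by
  have h := q44bTop_cells w a b c y
  linarith [h]

/-- **`Q44b ≤ Q44b-top` at law level**: the `Q44b` row `[P(ab|cy)+P(abcy)]·P(∅) − Σ(nine types)` is at most the `Q44b-top` margin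
`P(abcy)·P(∅) − Σ(eight join-top types)`; the difference is exactly the BHK two-link row.  (So, at law level, `Q44b-top ≥ 0` is the WEAKER
statement; the fibre statement (P1) keeps independent content only fibrewise.) [this work] -/
theorem q44b_margin_le_q44bTop_margin :
    (cell w a b c y 11 + cell w a b c y 14) * cell w a b c y 0 -
        (cell w a b c y 11 * (cell w a b c y 9 + cell w a b c y 8) +
          cell w a b c y 6 * (cell w a b c y 9 + cell w a b c y 8 + cell w a b c y 1 + cell w a b c y 10 + cell w a b c y 7) +
          cell w a b c y 7 * (cell w a b c y 5 + cell w a b c y 4)) ≤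
      cell w a b c y 14 * cell w a b c y 0 -
        (cell w a b c y 11 * (cell w a b c y 9 + cell w a b c y 8) +
          cell w a b c y 6 * (cell w a b c y 9 + cell w a b c y 8 + cell w a b c y 10 + cell w a b c y 7) +
          cell w a b c y 7 * (cell w a b c y 5 + cell w a b c y 4)) := by
  have h2 := twoLink_cell w a b c y
  linarith [h2]

end Q44bTop

end Summit.CriticalPhenomena.PercolationContinuityZ3.Theorems
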